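import Summits.BirchSwinnertonDyer.BirchSwinnertonDyer.Theorems.QuadraticBranchSignedControlPlusEtaNonsurjThetaFunctionalEquationReciprocityShape
import HarnessLib

/-!
# Route `QuadraticBranchSignedControl` (rung K8, cell `bsd-potss`), residual crux `PlusEtaMainConjectureNonsurj`
# (stmt-BirchSwinnertonDyer-19606): THE FUNCTIONAL EQUATION ON THE QUADRATIC BRANCH, XVIII — IDEAL-LEVEL RECIPROCITY: EVERY `ι`-STABLE
# PRINCIPAL IDEAL `(L) = (ι L)` OF `Λ` HAS A `(−1)^λ`-RECIPROCAL WEIERSTRASS POLYNOMIAL; COFACTORS BETWEEN `ι`-STABLE IDEALS ARE `ι`-STABLE;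
# THE KATO COFACTOR OF `L_p^±(V, η, X)` OVER ANY `ι`-STABLE DIVISOR IS RECIPROCAL (seat `bsd-potss-k8eta-c2` g29; kernel, class-wide)

WHY. Part XVI derived the reciprocity `(1+T)^d ι P = w P` of the Weierstrass polynomial from an exact functional equation
`ι L = w·(1+T)^e·L`. The argument only used that the multiplier `w(1+T)^e` is a UNIT of `Λ`. THIS FILE records the general form and its
consequences: (§44) **`ι L = u·L` with ANY `u ∈ Λˣ` and `L = a·P·U` ⇒ `(1+T)^d ι P = u(0)·P`**; (§45) applying `ι` once more,
`u(0)² = 1`, so `u(0) = ±1` and (Part XVI §37, `p` odd) **`u(0) = (−1)^d`**: the sign is FORCED by the degree; (§46) hence **EVERY `ι`-STABLE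
PRINCIPAL IDEAL `(ι L) = (L)` of `Λ` (`L ≠ 0`) has a `(−1)^d`-reciprocal Weierstrass polynomial, `P(−1) = (−1)^d`, and `d = λ(L)` is EVEN as
soon as `L(0) ≠ 0`** — the element-level refinement of the tree's `ι`-ledger (`IwasawaAlgebraInvolutionEvenLambdaProofs`: `ι`-fixed PRIMES
`∌ T` have even `λ`; here: full palindromicity of the distinguished polynomial of any `ι`-stable principal ideal); (§47) if `(L)` and `(g)` are
`ι`-stable and `L = g·h` (`g ≠ 0`) then `(h)` is `ι`-stable (`Associated.of_mul_left`), so COFACTORS inherit reciprocity: a cofactor of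
degree `1` is `T` (never `T − c`, `c ≠ 0`: k8eta-c1's `not_associated_invol_X_sub_C` in sharper form), a cofactor of degree `2` with `h(0) ≠ 0`
is `T² + aT + a`; (§48) ON THE QUADRATIC BRANCH: `(L_p^±(V, η, X))` is `ι`-stable (Part X `span_invol_eq_…`), so for EVERY `ι`-stable `(g)`
dividing a branch function — e.g. `Char_Λ X^±(V/K_∞)^η` granted B. D. Kim's algebraic functional equation (named fact
`Kim2008.thm311_etaSignedSelmerDual_charIdeal_map_invol`, used by k8eta-c1's 19601 squeeze; NOT used in this file) and Kato's divisibility —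
the cofactor's Weierstrass polynomial `R` satisfies `(1+T)^{deg R} ι R = (−1)^{deg R} R`, `R(−1) = (−1)^{deg R}`: the "missing part" of the
`η`-main conjecture at a pair, if nontrivial, is itself a reciprocal distinguished polynomial (degree `1` impossible unless `R = T`; degree `2`
and `R(0) ≠ 0` ⇒ one `p`-adic parameter).

WHAT. §44 **`one_add_X_pow_mul_invol_coe_eq_of_invol_eq_unit_mul`**; §45 `sq_eq_one_of_reciprocal`, `eq_neg_one_pow_of_reciprocal`;
§46 **`reciprocal_of_span_invol_eq`**, `exists_reciprocal_weierstrass_of_span_invol_eq` (`d = λ(L)`), **`even_lam_of_span_invol_eq`**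
(`L(0) ≠ 0 ⇒ λ(L)` even), `eq_X_of_reciprocal_one` (degree one ⇒ `P = T`); §47 **`span_invol_eq_of_mul`** (cofactors), `reciprocal_cofactor`;
§48 `reciprocal_cofactor_of_isQuadraticBranch{Plus,Minus}LFunction`, row `reciprocal_cofactor_plus_row`, `cofactor_shape_plus_row`
(`deg R = 1 ⇒ R = T`; `deg R = 2 ⇒ R = T² + aT + a`).

HONEST FRAMING (cell `bsd-potss`; FULL-BSD rank ≤ 1 programme, HUMAN RULING D-0036/D-0074): TOOL THEOREMS ONLY — no definition, no named
fact, no `sorry`, axioms standard; nothing about (A), (C1⁺_η), (E⁺_η), C-cc-1 or `BSD(W,p)` of any pair is claimed; no stub of 19606 (or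
19601) is proved; crux and route OPEN; nothing booked. `--supports stmt-BirchSwinnertonDyer-19606`.

References: [MazurTateTeitelbaum1986Invent] §I.17; [GreenbergLNM1716] §1 (pp. 67–68), §5 (p. 181); [Washington1997] §7.1 (Thm. 7.3), §13.2;
[KimBD2008MRL] Thm. 3.11 (the algebraic functional equation; context only); [Kobayashi2003] Thm. 3.2. Tree: Parts X, XVI, XVII;
`IwasawaAlgebraInvolutionEvenLambdaProofs.lean`; `…PlusEtaLowerInclusionFunctionalEquationSqueezeAlgebra.lean` (k8eta-c1 g11).
-/

set_option autoImplicit false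
set_option linter.dupNamespace false
noncomputable section

open scoped Classical MatrixGroups ModularForm

open CongruenceSubgroup WeierstrassCurve Literature.NumberTheory.EllipticCurves
  Literature.NumberTheory.EllipticCurves.ModularForms
open Literature.NumberTheory.EllipticCurves.IwasawaAlgebra
open Summit.BirchSwinnertonDyer.Rank1Residual.Additive
open Summit.BirchSwinnertonDyer.Rank1Residual.X1.MuLambda (mu lam)

namespace Summit.BirchSwinnertonDyer.BirchSwinnertonDyer.Theorems.EtaThetaFunctionalEquation

variable {p : ℕ} [hp : Fact p.Prime]

/-! ## §44 Reciprocity from `ι L = u·L` with ANY unit multiplier `u` -/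

/-- **`(1+T)^d · ι P = u(0) · P`**: if `L = a·P·U` (`a ≠ 0`, `P` distinguished of degree `d`, `U ∈ Λˣ`) and `ι L = u·L` for SOME `u ∈ Λ`
(a unit in every application; the identity needs no hypothesis on `u`, and §45 then forces `u(0) = ±1`), then the Weierstrass polynomial is
`u(0)`-reciprocal in `1+T`. (Part XVI §36 is the case `u = w(1+T)^e`.)
[cite: MazurTateTeitelbaum1986Invent, §I.17] [cite: Washington1997, §7.1, §13.2] -/
theorem one_add_X_pow_mul_invol_coe_eq_of_invol_eq_unit_mul {P : Polynomial ℤ_[p]}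
    (hP : P.IsDistinguishedAt (IsLocalRing.maximalIdeal ℤ_[p])) {a : ℤ_[p]} (ha : a ≠ 0) {U : IwasawaAlgebra p} (hU : IsUnit U)
    {L : IwasawaAlgebra p} (hL : L = PowerSeries.C a * (P : IwasawaAlgebra p) * U) {u : IwasawaAlgebra p}
    (hFE : invol p L = u * L) :
    (1 + PowerSeries.X) ^ P.natDegree * invol p (P : IwasawaAlgebra p) =
      PowerSeries.C (PowerSeries.constantCoeff u) * (P : IwasawaAlgebra p) := by
  obtain ⟨V, hV⟩ := (hU.map (invol p)).exists_right_inv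
  have hCa : (PowerSeries.C a : IwasawaAlgebra p) ≠ 0 := fun h ↦ ha (by simpa using congr_arg PowerSeries.constantCoeff h)
  have h1 : invol p (P : IwasawaAlgebra p) * invol p U = u * (P : IwasawaAlgebra p) * U := by
    refine mul_left_cancel₀ hCa ?_
    have h := hFE
    rw [hL, map_mul (invol p), map_mul (invol p), invol_C] at h
    linear_combination h
  set K : IwasawaAlgebra p := u * (1 + PowerSeries.X) ^ P.natDegree * U * V with hKdef
  have h2 : (1 + PowerSeries.X) ^ P.natDegree * invol p (P : IwasawaAlgebra p) = (P : IwasawaAlgebra p) * K := by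
    rw [hKdef]
    linear_combination ((1 + PowerSeries.X) ^ P.natDegree * V) * h1 -
      ((1 + PowerSeries.X) ^ P.natDegree * invol p (P : IwasawaAlgebra p)) * hV
  have h3 : K = PowerSeries.C (PowerSeries.constantCoeff K) :=
    eq_C_of_distinguished_mul hP fun n hn ↦ by rw [← h2]; exact coeff_one_add_X_pow_mul_invol_coe_eq_zero P hn
  have h0 : ‖(0 : ℤ_[p])‖ < 1 := by rw [norm_zero]; exact zero_lt_one
  have hUV : PowerSeries.constantCoeff U * PowerSeries.constantCoeff V = 1 := by
    have h := congr_arg (evalHom 0 h0) hV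
    rwa [map_mul, map_one, evalHom_invol h0 h0 (by ring) U, evalHom_zero_eq_constantCoeff, evalHom_zero_eq_constantCoeff] at h
  have h4 : PowerSeries.constantCoeff K = PowerSeries.constantCoeff u := by
    rw [hKdef, map_mul, map_mul, map_mul, map_pow, map_add, map_one, PowerSeries.constantCoeff_X, add_zero, one_pow, mul_one, mul_assoc,
      hUV, mul_one]
  rw [h2, h3, h4, mul_comm]

/-! ## §45 The sign is forced: `c² = 1`, `c = (−1)^d` -/

/-- **`c² = 1`**: a MONIC `P` with `(1+T)^d ι P = c·P` has `c·c = 1` — apply `ι` once more and use `(1+T)·ι(1+T) = 1`, `ι ∘ ι = id`.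
[cite: MazurTateTeitelbaum1986Invent, §I.17] [cite: Washington1997, §13.2] -/
theorem sq_eq_one_of_reciprocal {P : Polynomial ℤ_[p]} (hmon : P.Monic) {c : ℤ_[p]}
    (h : (1 + PowerSeries.X) ^ P.natDegree * invol p (P : IwasawaAlgebra p) = PowerSeries.C c * (P : IwasawaAlgebra p)) :
    c * c = 1 := by
  have hι := congr_arg (invol p) h
  rw [map_mul (invol p), map_pow, invol_invol, map_mul (invol p), invol_C] at hι
  have hE : ((1 + PowerSeries.X) * invol p (1 + PowerSeries.X)) ^ P.natDegree = (1 : IwasawaAlgebra p) := by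
    rw [one_add_X_mul_invol_one_add_X, one_pow]
  have key : invol p (P : IwasawaAlgebra p) = PowerSeries.C c * (PowerSeries.C c * invol p (P : IwasawaAlgebra p)) := by
    calc invol p (P : IwasawaAlgebra p)
        = ((1 + PowerSeries.X) * invol p (1 + PowerSeries.X)) ^ P.natDegree * invol p (P : IwasawaAlgebra p) := by rw [hE, one_mul]
      _ = invol p (1 + PowerSeries.X) ^ P.natDegree * ((1 + PowerSeries.X) ^ P.natDegree * invol p (P : IwasawaAlgebra p)) := by
          rw [mul_pow]; ring
      _ = PowerSeries.C c * (invol p (1 + PowerSeries.X) ^ P.natDegree * (P : IwasawaAlgebra p)) := by rw [h]; ring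
      _ = PowerSeries.C c * (PowerSeries.C c * invol p (P : IwasawaAlgebra p)) := by rw [hι]
  have hP0 : invol p (P : IwasawaAlgebra p) ≠ 0 := by
    intro h0
    apply hmon.ne_zero
    apply Polynomial.coe_injective
    rw [Polynomial.coe_zero]
    exact invol_injective p (by rw [h0, map_zero])
  have h2 : (1 - PowerSeries.C (c * c)) * invol p (P : IwasawaAlgebra p) = 0 := by rw [map_mul]; linear_combination key
  rcases mul_eq_zero.mp h2 with h3 | h3
  · have h4 := congr_arg PowerSeries.constantCoeff h3
    rw [map_sub, map_one, PowerSeries.constantCoeff_C, map_zero] at h4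
    linear_combination -h4
  · exact absurd h3 hP0

/-- **`c = (−1)^d`** (`p` odd, `P` distinguished): the only possible sign of a reciprocity `(1+T)^d ι P = c P` is `(−1)^d`.
[cite: MazurTateTeitelbaum1986Invent, §I.17] [cite: Washington1997, §7.1] -/
theorem eq_neg_one_pow_of_reciprocal (hp2 : p ≠ 2) {P : Polynomial ℤ_[p]} (hP : P.IsDistinguishedAt (IsLocalRing.maximalIdeal ℤ_[p]))
    {c : ℤ_[p]} (h : (1 + PowerSeries.X) ^ P.natDegree * invol p (P : IwasawaAlgebra p) = PowerSeries.C c * (P : IwasawaAlgebra p)) :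
    c = (-1) ^ P.natDegree :=
  sign_eq_neg_one_pow_natDegree_of_reciprocal hp2 hP (mul_self_eq_one_iff.mp (sq_eq_one_of_reciprocal hP.monic h)) h

/-! ## §46 Every `ι`-stable principal ideal of `Λ` has a `(−1)^λ`-reciprocal Weierstrass polynomial -/

/-- **IDEAL-LEVEL RECIPROCITY.** For `p` odd, `L ≠ 0` with `(ι L) = (L)` as ideals of `Λ`, and ANY Weierstrass datum `L = a·P·U` (`a ≠ 0`,
`P` distinguished of degree `d`, `U ∈ Λˣ`): `(1+T)^d ι P = (−1)^d P` and `P(−1) = (−1)^d`. [cite: MazurTateTeitelbaum1986Invent, §I.17]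
[cite: GreenbergLNM1716, §1 (pp. 67–68)] [cite: Washington1997, §7.1, §13.2] -/
theorem reciprocal_of_span_invol_eq (hp2 : p ≠ 2) {L : IwasawaAlgebra p}
    (hspan : Ideal.span {invol p L} = Ideal.span {L}) {P : Polynomial ℤ_[p]}
    (hP : P.IsDistinguishedAt (IsLocalRing.maximalIdeal ℤ_[p])) {a : ℤ_[p]} (ha : a ≠ 0) {U : IwasawaAlgebra p} (hU : IsUnit U)
    (hLP : L = PowerSeries.C a * (P : IwasawaAlgebra p) * U) :
    (1 + PowerSeries.X) ^ P.natDegree * invol p (P : IwasawaAlgebra p) =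
        PowerSeries.C ((-1) ^ P.natDegree) * (P : IwasawaAlgebra p) ∧ P.eval (-1) = (-1) ^ P.natDegree := by
  obtain ⟨u, hu⟩ := Ideal.span_singleton_eq_span_singleton.mp hspan
  have hFE : invol p L = (↑u⁻¹ : IwasawaAlgebra p) * L := by
    calc invol p L = invol p L * ((u : IwasawaAlgebra p) * ↑u⁻¹) := by rw [Units.mul_inv, mul_one]
      _ = ↑u⁻¹ * (invol p L * ↑u) := by ring
      _ = ↑u⁻¹ * L := by rw [hu]
  have hrec := one_add_X_pow_mul_invol_coe_eq_of_invol_eq_unit_mul hP ha hU hLP hFE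
  have hc := eq_neg_one_pow_of_reciprocal hp2 hP hrec
  rw [hc] at hrec
  exact ⟨hrec, eval_neg_one_eq_of_reciprocal hP.monic hrec⟩

/-- **Existence with `d = λ(L)`**: an `ι`-stable `(L)`, `L ≠ 0`, has `L = p^{μ(L)}·P·U` with `P` distinguished of degree `λ(L)`,
`(1+T)^{λ(L)} ι P = (−1)^{λ(L)} P`, `P(−1) = (−1)^{λ(L)}`. [cite: Washington1997, §7.1 (Thm. 7.3)] [cite: MazurTateTeitelbaum1986Invent, §I.17] -/
theorem exists_reciprocal_weierstrass_of_span_invol_eq (hp2 : p ≠ 2) {L : IwasawaAlgebra p} (hL0 : L ≠ 0)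
    (hspan : Ideal.span {invol p L} = Ideal.span {L}) :
    ∃ (P : Polynomial ℤ_[p]) (U : IwasawaAlgebra p), P.IsDistinguishedAt (IsLocalRing.maximalIdeal ℤ_[p]) ∧ IsUnit U ∧
      P.natDegree = lam L ∧ L = PowerSeries.C ((p : ℤ_[p]) ^ mu L) * (P : IwasawaAlgebra p) * U ∧
      (1 + PowerSeries.X) ^ lam L * invol p (P : IwasawaAlgebra p) = PowerSeries.C ((-1) ^ lam L) * (P : IwasawaAlgebra p) ∧
      P.eval (-1) = (-1) ^ lam L := by
  obtain ⟨P, U, hP, hU, hdeg, hLP⟩ := exists_weierstrass_of_ne_zero hL0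
  obtain ⟨h1, h2⟩ := reciprocal_of_span_invol_eq hp2 hspan hP (pow_ne_zero _ (Nat.cast_ne_zero.mpr hp.out.ne_zero)) hU hLP
  exact ⟨P, U, hP, hU, hdeg, hLP, hdeg ▸ h1, hdeg ▸ h2⟩

/-- **`λ(L)` IS EVEN for an `ι`-stable `(L)` with `L(0) ≠ 0`** (`p` odd): the constant terms of `(1+T)^λ ι P = (−1)^λ P` give
`P(0) = (−1)^λ P(0)` with `P(0) ≠ 0`. (Element-level companion of the tree's `even_lambdaInvariant_quotient_of_comap_invol_eq` for
`ι`-fixed primes.) [cite: MazurTateTeitelbaum1986Invent, §I.17] [cite: Washington1997, §7.1] -/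
theorem even_lam_of_span_invol_eq (hp2 : p ≠ 2) {L : IwasawaAlgebra p} (hL0 : PowerSeries.constantCoeff L ≠ 0)
    (hspan : Ideal.span {invol p L} = Ideal.span {L}) : Even (lam L) := by
  have hL : L ≠ 0 := fun h ↦ hL0 (by rw [h, map_zero])
  obtain ⟨P, U, -, -, -, hLP, h1, -⟩ := exists_reciprocal_weierstrass_of_span_invol_eq hp2 hL hspan
  have hP0 : P.coeff 0 ≠ 0 := by
    intro h0
    apply hL0
    rw [hLP, map_mul, map_mul, ← PowerSeries.coeff_zero_eq_constantCoeff_apply (P : IwasawaAlgebra p), Polynomial.coeff_coe, h0,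
      mul_zero, zero_mul]
  have hc := congr_arg PowerSeries.constantCoeff h1
  rw [map_mul, map_mul, map_pow, map_add, map_one, PowerSeries.constantCoeff_X, add_zero, one_pow, one_mul, constantCoeff_invol,
    PowerSeries.constantCoeff_C, ← PowerSeries.coeff_zero_eq_constantCoeff_apply, Polynomial.coeff_coe] at hc
  have h2 : ((-1 : ℤ_[p]) ^ lam L - 1) * P.coeff 0 = 0 := by linear_combination -hc
  rcases mul_eq_zero.mp h2 with h3 | h3
  · have hne : (-1 : ℤ_[p]) ≠ 1 := fun h ↦ two_ne_zero (α := ℤ_[p]) (by linear_combination -h)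
    exact (neg_one_pow_eq_one_iff_even hne).mp (by linear_combination h3)
  · exact absurd h3 hP0

/-- **A reciprocal distinguished polynomial of degree ONE is `T`** (`p` odd): `P = T + c`, `P(−1) = −1 + c = (−1)^1` forces `c = 0` — a lone
linear factor `T − c`, `c ≠ 0`, never generates an `ι`-stable ideal (k8eta-c1's `not_associated_invol_X_sub_C`, sharpened).
[cite: GreenbergLNM1716, §5 (p. 181: "a = 0")] [cite: Washington1997, §13.2] -/
theorem eq_X_of_reciprocal_one {P : Polynomial ℤ_[p]} (hmon : P.Monic) (hdeg : P.natDegree = 1) {c : ℤ_[p]}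
    (h : (1 + PowerSeries.X) ^ P.natDegree * invol p (P : IwasawaAlgebra p) = PowerSeries.C c * (P : IwasawaAlgebra p))
    (hc : c = (-1) ^ P.natDegree) : P = Polynomial.X := by
  have hev := eval_neg_one_eq_of_reciprocal hmon h
  rw [hc, hdeg, pow_one, hmon.eq_X_add_C hdeg, Polynomial.eval_add, Polynomial.eval_X, Polynomial.eval_C] at hev
  rw [hmon.eq_X_add_C hdeg, show P.coeff 0 = 0 by linear_combination hev, map_zero, add_zero]

/-! ## §47 Cofactors between `ι`-stable principal ideals are `ι`-stable -/

/-- **COFACTORS.** If `(ι L) = (L)`, `(ι g) = (g)`, `L = g·h` and `g ≠ 0`, then `(ι h) = (h)` (`ι` is multiplicative and `Λ` is a domain: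
`Associated.of_mul_left`). [cite: GreenbergLNM1716, §1 (pp. 67–68)] [cite: Washington1997, §13.2] -/
theorem span_invol_eq_of_mul {L g h : IwasawaAlgebra p} (hg0 : g ≠ 0) (hLgh : L = g * h)
    (hL : Ideal.span {invol p L} = Ideal.span {L}) (hg : Ideal.span {invol p g} = Ideal.span {g}) :
    Ideal.span {invol p h} = Ideal.span {h} := by
  rw [Ideal.span_singleton_eq_span_singleton] at hL hg ⊢
  rw [hLgh, map_mul (invol p)] at hL
  exact Associated.of_mul_left hL hg (fun h0 ↦ hg0 (invol_injective p (by rw [h0, map_zero])))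

/-- **THE COFACTOR IS RECIPROCAL** (`p` odd): `(ι L) = (L)`, `(ι g) = (g)`, `L = g·h`, `g ≠ 0`, and any Weierstrass datum `h = a·R·U` of the
cofactor: `(1+T)^{deg R} ι R = (−1)^{deg R} R` and `R(−1) = (−1)^{deg R}`. [cite: MazurTateTeitelbaum1986Invent, §I.17]
[cite: GreenbergLNM1716, §1 (pp. 67–68), §5 (p. 181)] -/
theorem reciprocal_cofactor (hp2 : p ≠ 2) {L g h : IwasawaAlgebra p} (hg0 : g ≠ 0) (hLgh : L = g * h)
    (hL : Ideal.span {invol p L} = Ideal.span {L}) (hg : Ideal.span {invol p g} = Ideal.span {g})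
    {R : Polynomial ℤ_[p]} (hR : R.IsDistinguishedAt (IsLocalRing.maximalIdeal ℤ_[p])) {a : ℤ_[p]} (ha : a ≠ 0)
    {U : IwasawaAlgebra p} (hU : IsUnit U) (hhR : h = PowerSeries.C a * (R : IwasawaAlgebra p) * U) :
    (1 + PowerSeries.X) ^ R.natDegree * invol p (R : IwasawaAlgebra p) =
        PowerSeries.C ((-1) ^ R.natDegree) * (R : IwasawaAlgebra p) ∧ R.eval (-1) = (-1) ^ R.natDegree :=
  reciprocal_of_span_invol_eq hp2 (span_invol_eq_of_mul hg0 hLgh hL hg) hR ha hU hhR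

/-! ## §48 On the quadratic branch: the cofactor of `L_p^±(V, η, X)` over any `ι`-stable divisor is reciprocal -/

section Branch

variable {N : ℕ} [NeZero N] {f : CuspForm (Gamma0 N) 2}

/-- **THE KATO COFACTOR OF `L_p⁺(V, η, X)` IS RECIPROCAL**: `p` odd, `f` a rational newform of level `N` prime to `p`, `a_p(f) = 0`, any `ϖ`,
`L` a plus branch function; for EVERY `g ≠ 0` with `(ι g) = (g)` and `L = g·h` (e.g. a generator of an `ι`-stable characteristic ideal
dividing `L`) and every datum `h = a·R·U`: `(1+T)^{deg R} ι R = (−1)^{deg R} R`, `R(−1) = (−1)^{deg R}`. No named fact is used ((`ι L) = (L)` is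
Part X). [cite: MazurTateTeitelbaum1986Invent, §I.17] [cite: GreenbergLNM1716, §1 (pp. 67–68), §5 (p. 181)] [cite: Kobayashi2003, Thm. 3.2, (3.4)] -/
theorem reciprocal_cofactor_of_isQuadraticBranchPlusLFunction (hp2 : p ≠ 2) (hf0 : IsNewform0 f) (hQ : coeffField f = ⊥)
    (hpN : ¬ p ∣ N) (hap : cuspCoeff f p = ((0 : ℤ) : ℂ)) {ϖ : ℚ} {L : IwasawaAlgebra p}
    (hL : IsQuadraticBranchPlusLFunction f p ϖ L) {g h : IwasawaAlgebra p} (hg0 : g ≠ 0) (hLgh : L = g * h)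
    (hg : Ideal.span {invol p g} = Ideal.span {g}) {R : Polynomial ℤ_[p]} (hR : R.IsDistinguishedAt (IsLocalRing.maximalIdeal ℤ_[p]))
    {a : ℤ_[p]} (ha : a ≠ 0) {U : IwasawaAlgebra p} (hU : IsUnit U) (hhR : h = PowerSeries.C a * (R : IwasawaAlgebra p) * U) :
    (1 + PowerSeries.X) ^ R.natDegree * invol p (R : IwasawaAlgebra p) =
        PowerSeries.C ((-1) ^ R.natDegree) * (R : IwasawaAlgebra p) ∧ R.eval (-1) = (-1) ^ R.natDegree :=
  reciprocal_cofactor hp2 hg0 hLgh (span_invol_eq_of_isQuadraticBranchPlusLFunction hp2 hf0 hQ hpN hap hL) hg hR ha hU hhR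

/-- **THE KATO COFACTOR OF `L_p⁻(V, η, X)` IS RECIPROCAL** (minus twin). [cite: MazurTateTeitelbaum1986Invent, §I.17]
[cite: GreenbergLNM1716, §1 (pp. 67–68), §5 (p. 181)] [cite: Kobayashi2003, Thm. 3.2, (3.5)] -/
theorem reciprocal_cofactor_of_isQuadraticBranchMinusLFunction (hp2 : p ≠ 2) (hf0 : IsNewform0 f) (hQ : coeffField f = ⊥)
    (hpN : ¬ p ∣ N) (hap : cuspCoeff f p = ((0 : ℤ) : ℂ)) {ϖ : ℚ} {L : IwasawaAlgebra p}
    (hL : IsQuadraticBranchMinusLFunction f p ϖ L) {g h : IwasawaAlgebra p} (hg0 : g ≠ 0) (hLgh : L = g * h)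
    (hg : Ideal.span {invol p g} = Ideal.span {g}) {R : Polynomial ℤ_[p]} (hR : R.IsDistinguishedAt (IsLocalRing.maximalIdeal ℤ_[p]))
    {a : ℤ_[p]} (ha : a ≠ 0) {U : IwasawaAlgebra p} (hU : IsUnit U) (hhR : h = PowerSeries.C a * (R : IwasawaAlgebra p) * U) :
    (1 + PowerSeries.X) ^ R.natDegree * invol p (R : IwasawaAlgebra p) =
        PowerSeries.C ((-1) ^ R.natDegree) * (R : IwasawaAlgebra p) ∧ R.eval (-1) = (-1) ^ R.natDegree :=
  reciprocal_cofactor hp2 hg0 hLgh (span_invol_eq_of_isQuadraticBranchMinusLFunction hp2 hf0 hQ hpN hap hL) hg hR ha hU hhR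

end Branch

section Row

variable {N : ℕ} [NeZero N] {f : CuspForm (Gamma0 N) 2}

/-- **AT A ROW (plus)**: `V` globally minimal, good at `p ≥ 5`, `a_p(V) = 0`, `f` its newform, any `ϖ`, `Lη` a plus branch function,
`g ≠ 0` with `(ι g) = (g)`, `Lη = g·h`, datum `h = a·R·U`: the cofactor's Weierstrass polynomial is `(−1)^{deg R}`-reciprocal and
`R(−1) = (−1)^{deg R}`. [cite: MazurTateTeitelbaum1986Invent, §I.17] [cite: GreenbergLNM1716, §5 (p. 181)] -/
theorem reciprocal_cofactor_plus_row (hp5 : 5 ≤ p) (V : WeierstrassCurve ℚ) [V.IsElliptic] [V.IsGloballyMinimal]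
    (hgood : V.HasGoodReductionAtPrime p) (hap : V.frobeniusTrace p = 0) (hf : IsNewformOf V f) (ϖ : ℚ) {Lη : IwasawaAlgebra p}
    (hL : IsQuadraticBranchPlusLFunction f p ϖ Lη) {g h : IwasawaAlgebra p} (hg0 : g ≠ 0) (hLgh : Lη = g * h)
    (hg : Ideal.span {invol p g} = Ideal.span {g}) {R : Polynomial ℤ_[p]} (hR : R.IsDistinguishedAt (IsLocalRing.maximalIdeal ℤ_[p]))
    {a : ℤ_[p]} (ha : a ≠ 0) {U : IwasawaAlgebra p} (hU : IsUnit U) (hhR : h = PowerSeries.C a * (R : IwasawaAlgebra p) * U) :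
    (1 + PowerSeries.X) ^ R.natDegree * invol p (R : IwasawaAlgebra p) =
        PowerSeries.C ((-1) ^ R.natDegree) * (R : IwasawaAlgebra p) ∧ R.eval (-1) = (-1) ^ R.natDegree := by
  have hp2 : p ≠ 2 := by omega
  exact reciprocal_cofactor hp2 hg0 hLgh (span_invol_eq_plus_row hp5 V hgood hap hf ϖ hL) hg hR ha hU hhR

/-- **AT A ROW (plus), SMALL COFACTORS**: in the same situation, `deg R = 1 ⇒ R = T` (a lone linear cofactor is the trivial zero) and
`deg R = 2 ⇒ R = T² + aT + a` with `a = R(0) ∈ pℤ_p` (one `p`-adic parameter; `a = 0` iff `R = T²`). [cite: GreenbergLNM1716, §5 (p. 181)]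
[cite: MazurTateTeitelbaum1986Invent, §I.17] [cite: Washington1997, §7.1] -/
theorem cofactor_shape_plus_row (hp5 : 5 ≤ p) (V : WeierstrassCurve ℚ) [V.IsElliptic] [V.IsGloballyMinimal]
    (hgood : V.HasGoodReductionAtPrime p) (hap : V.frobeniusTrace p = 0) (hf : IsNewformOf V f) (ϖ : ℚ) {Lη : IwasawaAlgebra p}
    (hL : IsQuadraticBranchPlusLFunction f p ϖ Lη) {g h : IwasawaAlgebra p} (hg0 : g ≠ 0) (hLgh : Lη = g * h)
    (hg : Ideal.span {invol p g} = Ideal.span {g}) {R : Polynomial ℤ_[p]} (hR : R.IsDistinguishedAt (IsLocalRing.maximalIdeal ℤ_[p]))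
    {a : ℤ_[p]} (ha : a ≠ 0) {U : IwasawaAlgebra p} (hU : IsUnit U) (hhR : h = PowerSeries.C a * (R : IwasawaAlgebra p) * U) :
    (R.natDegree = 1 → R = Polynomial.X) ∧
      (R.natDegree = 2 → R = Polynomial.X ^ 2 + Polynomial.C (R.coeff 0) * Polynomial.X + Polynomial.C (R.coeff 0)) := by
  have hp2 : p ≠ 2 := by omega
  obtain ⟨hrec, hev⟩ := reciprocal_cofactor_plus_row hp5 V hgood hap hf ϖ hL hg0 hLgh hg hR ha hU hhR
  refine ⟨fun h1 ↦ eq_X_of_reciprocal_one hR.monic h1 hrec rfl, fun h2 ↦ ?_⟩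
  have hw : ((-1 : ℤ_[p]) ^ R.natDegree) = 1 ∨ ((-1 : ℤ_[p]) ^ R.natDegree) = -1 := by rw [h2]; left; norm_num
  exact (eq_X_sq_add_of_reciprocal_two hp2 hR h2 hw hev).1

end Row

end Summit.BirchSwinnertonDyer.BirchSwinnertonDyer.Theorems.EtaThetaFunctionalEquation

end
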